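import Summits.NavierStokesRegularity.NavierStokesRegularity.Theses.PlaneEnergyCeiling
import Literature.Analysis.FluidPDE.NSQuasipotential

/-!
# `BoundedPlanarEnergyRegularity` (stmt-NavierStokesRegularity-16921): the Leray–Hopf clause of the planar hypothesis is load-bearing

Negative (support) lemmas for the crux `PlaneEnergyCeiling.BoundedPlanarEnergyRegularity`
(route `PlaneEnergyCeiling`, co-ranked 3), extracted from the crux-attack work file
`Cruxes/BoundedPlanarEnergyRegularity/Disproof.lean` (refuter crux-attack seat, 2026-08-17).

The crux reads `∀ ν > 0, ∀ Clay datum u₀, PlanarHyp ν u₀ → Clay (A)(u₀)`, where the inner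
hypothesis `PlanarHyp ν u₀` says: every classical solution `(u, p)` on `[0, T)` that is
LERAY–HOPF on `[0, T]` from `u 0 = u₀` has planar kinetic energies
`∫_{R({x₂ = c})} |u(t)|² dA` bounded uniformly in `t < T`, `R`, `c` (every `T > 0`).

* `planar_bound_of_zero_datum` — WITH the Leray–Hopf clause the inner hypothesis HOLDS at the zero
  datum (`ν ≥ 0`): by the energy inequality from `s = 0` every Leray–Hopf field from `0` has zero
  energy at every `t ∈ [0, T]`, and a continuous slice of zero energy vanishes identically
  (`eq_zero_of_isLerayHopfOn_zero_datum`), so `M = 0` bounds every planar energy. Together with the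
  rest state solving Clay (A) from `0`, the crux instance at `u₀ = 0` is "true → true" (not vacuous).
* `planar_bound_false_without_lerayHopf` — WITHOUT the Leray–Hopf clause the inner hypothesis is
  FALSE already at the zero datum: the accelerating Galilean drift `u(t, x) = t • e`,
  `p(t, x) = -⟪e, x⟫` (Serrin / KNSS 2009 §1 "parasitic solutions") is a classical solution of
  unforced NS on `[0, T)` from `u 0 = 0` (`isClassicalNSSolutionOn_accelDrift`) whose planar energy
  through every plane is `⊤` at every `t ≠ 0` (`planarEnergy_accelDrift_eq_top`).

Consequence for provers: the LH-free variant of the crux is VACUOUSLY true at `u₀ = 0` (and, riding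
the same drift on the local smooth solution by Galilean invariance, at every datum), so the
finite-energy clause is exactly what gives the criterion content; whoever USES the crux (the zoom
stub at `T = T*`) must hand it a field that is Leray–Hopf on the CLOSED interval `[0, T*]`
(e.g. `u(T*) :=` the weak-`L²` limit). [folklore]
-/

noncomputable section

namespace Summit.NavierStokesRegularity.NavierStokesRegularity.Theorems.BoundedPlanarEnergyRegularityNegative

open Set Filter Topology MeasureTheory Function
open scoped InnerProductSpace RealInnerProductSpace ContDiff ENNReal Laplacian
open Literature.Analysis.FluidPDE

/-! ## With the Leray–Hopf clause: the zero datum satisfies the planar hypothesis -/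

/-- **Energy uniqueness from rest.** A Leray–Hopf field (`ν ≥ 0`, unforced) from the zero datum
whose slice `u t` is continuous vanishes identically at every `t ∈ [0, T]`: the energy inequality
from `s = 0` gives `½‖u t‖₂² + ν·D ≤ ½‖0‖₂² + 0`, so `∫⁻ ‖u t‖ₑ² = 0`, so `u t = 0` a.e., hence
everywhere. [folklore] -/
theorem eq_zero_of_isLerayHopfOn_zero_datum {ν T : ℝ} (hν : 0 ≤ ν) {u : ℝ → (EuclideanSpace ℝ (Fin 3)) → (EuclideanSpace ℝ (Fin 3))}
    (hLH : IsLerayHopfOn T ν 0 0 u) {t : ℝ} (ht : t ∈ Icc 0 T) (hcont : Continuous (u t)) :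
    u t = 0 := by
  obtain ⟨G, -, -, h0, -⟩ := hLH.weakGrad_energy
  have hineq := h0 t ht
  have hK0 : VectorCalculus.kineticEnergy (0 : (EuclideanSpace ℝ (Fin 3)) → (EuclideanSpace ℝ (Fin 3))) = 0 := by
    simp [VectorCalculus.kineticEnergy]
  simp only [hK0, Pi.zero_apply, inner_zero_left, integral_zero, intervalIntegral.integral_zero,
    add_zero] at hineq
  have hD : 0 ≤ ν * (∫⁻ τ in Ioo 0 t, ∫⁻ x, ENNReal.ofReal (frobeniusNormSq (G τ x))).toReal :=
    mul_nonneg hν ENNReal.toReal_nonneg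
  have hKle : VectorCalculus.kineticEnergy (u t) ≤ 0 := by linarith
  have hK : VectorCalculus.kineticEnergy (u t) = 0 := le_antisymm hKle (kineticEnergy_nonneg _)
  have hE : eEnergy (u t) = 0 := by
    rw [hLH.eEnergy_eq ht, hK, mul_zero, ENNReal.ofReal_zero]
  have hm : Measurable (u t) := hcont.measurable
  have hmeas : AEMeasurable (fun x => ‖u t x‖ₑ ^ 2) (volume : Measure (EuclideanSpace ℝ (Fin 3))) :=
    (hm.enorm.pow_const 2).aemeasurable
  have hae : (fun x => ‖u t x‖ₑ ^ 2) =ᵐ[volume] 0 := (lintegral_eq_zero_iff' hmeas).1 hE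
  have hae' : u t =ᵐ[volume] 0 := by
    filter_upwards [hae] with x hx
    simpa using hx
  exact Continuous.ae_eq_iff_eq volume hcont continuous_const |>.1 hae'

/-- **The planar hypothesis of the crux HOLDS at the zero datum** (`ν ≥ 0`): every classical
solution on `[0, T)` that is Leray–Hopf on `[0, T]` from `u 0 = 0` is identically `0` on `[0, T)`,
so `M = 0` bounds all its planar energies (the inner hypothesis of
`PlaneEnergyCeiling.BoundedPlanarEnergyRegularity`, verbatim, at `u₀ = 0`). [folklore] -/
theorem planar_bound_of_zero_datum {ν : ℝ} (hν : 0 ≤ ν) :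
    ∀ (T : ℝ), 0 < T → ∀ (u : ℝ → EuclideanSpace ℝ (Fin 3) → EuclideanSpace ℝ (Fin 3))
      (p : ℝ → EuclideanSpace ℝ (Fin 3) → ℝ),
      Literature.Analysis.FluidPDE.IsClassicalNSSolutionOn (Set.Ico 0 T) ν 0 u p →
      Literature.Analysis.FluidPDE.IsLerayHopfOn T ν 0 (u 0) u → u 0 = 0 →
      ∃ M : ℝ, ∀ t ∈ Set.Ico 0 T,
        ∀ (R : EuclideanSpace ℝ (Fin 3) ≃ₗᵢ[ℝ] EuclideanSpace ℝ (Fin 3)) (c : ℝ),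
          ∫⁻ y : EuclideanSpace ℝ (Fin 2), ‖u t (R (WithLp.toLp 2 ![y 0, y 1, c]))‖ₑ ^ 2
            ≤ ENNReal.ofReal M := by
  intro T _ u p hcl hLH h0
  refine ⟨0, fun t ht R c => ?_⟩
  have hLH' : IsLerayHopfOn T ν 0 0 u := by simpa [h0] using hLH
  have hcont : Continuous (u t) := (hcl.contDiff_velocity ht).continuous
  rw [eq_zero_of_isLerayHopfOn_zero_datum hν hLH' (Ico_subset_Icc_self ht) hcont]
  simp

/-! ## Without the Leray–Hopf clause: the accelerating Galilean drift -/

/-- The gradient of the linear functional `x ↦ -⟪e, x⟫` is `-e`. [folklore] -/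
theorem gradient_neg_inner_const_left (e x : (EuclideanSpace ℝ (Fin 3))) : gradient (fun y : (EuclideanSpace ℝ (Fin 3)) => -⟪e, y⟫) x = -e := by
  have h : HasFDerivAt (fun y : (EuclideanSpace ℝ (Fin 3)) => -⟪e, y⟫) (-(innerSL ℝ e)) x :=
    ((innerSL ℝ e).hasFDerivAt).neg
  rw [gradient, h.fderiv]
  apply (InnerProductSpace.toDual ℝ (EuclideanSpace ℝ (Fin 3))).injective
  rw [LinearIsometryEquiv.apply_symm_apply]
  ext y
  simp [InnerProductSpace.toDual_apply_apply]

/-- **The accelerating Galilean drift is a classical solution of unforced NS on `[0, T)`** (any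
`ν`): `u(t, x) = t • e`, `p(t, x) = -⟪e, x⟫` — `∂ₜu = e`, `(u·∇)u = 0`, `Δu = 0`, `∇p = -e`,
`div u = 0` (the "parasitic solutions" `u = b(t)`, `p = -b'(t)·x`). [cite: KochNadirashviliSereginSverak2009, §1 p. 3 (parasitic solutions u(x,t) = b(t))] -/
theorem isClassicalNSSolutionOn_accelDrift (ν T : ℝ) (e : (EuclideanSpace ℝ (Fin 3))) :
    IsClassicalNSSolutionOn (Ico 0 T) ν 0 (fun (t : ℝ) (_ : (EuclideanSpace ℝ (Fin 3))) => t • e)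
      (fun (_ : ℝ) (x : (EuclideanSpace ℝ (Fin 3))) => -⟪e, x⟫) where
  smooth_velocity := by
    unfold IsSmoothSpaceTimeOn
    exact (contDiff_fst.smul contDiff_const).contDiffOn
  smooth_pressure := by
    unfold IsSmoothSpaceTimeOn
    exact (contDiff_const.inner ℝ contDiff_snd).neg.contDiffOn
  momentum t ht x := by
    have h1 : timeDerivWithin (Ico 0 T) (fun (t : ℝ) (_ : (EuclideanSpace ℝ (Fin 3))) => t • e) t x = e := by
      rw [timeDerivWithin_apply]
      have hd : HasDerivWithinAt (fun s : ℝ => s • e) ((1 : ℝ) • e) (Ico 0 T) t :=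
        ((hasDerivAt_id t).smul_const e).hasDerivWithinAt
      rw [hd.derivWithin (uniqueDiffOn_Ico 0 T t ht), one_smul]
    have h2 : convect (fun _ : (EuclideanSpace ℝ (Fin 3)) => t • e) (fun _ : (EuclideanSpace ℝ (Fin 3)) => t • e) x = 0 := by
      simp [convect]
    have h3 : (Δ (fun _ : (EuclideanSpace ℝ (Fin 3)) => t • e)) x = 0 := by
      rw [InnerProductSpace.laplacian_const]
      rfl
    rw [h1, h2, h3, gradient_neg_inner_const_left]
    simp
  divFree t _ x := by
    simp [VectorCalculus.divergence]

/-- **Infinite planar energy of the drift**: for `e ≠ 0` and `t ≠ 0` the planar energy of the slice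
`x ↦ t • e` through every plane `R({x₂ = c})` is `⊤` (a nonzero constant over `(EuclideanSpace ℝ (Fin 2))`). [folklore] -/
theorem planarEnergy_accelDrift_eq_top {e : (EuclideanSpace ℝ (Fin 3))} (he : e ≠ 0) {t : ℝ} (ht : t ≠ 0)
    (R : (EuclideanSpace ℝ (Fin 3)) ≃ₗᵢ[ℝ] (EuclideanSpace ℝ (Fin 3))) (c : ℝ) :
    ∫⁻ y : (EuclideanSpace ℝ (Fin 2)), ‖(fun (t : ℝ) (_ : (EuclideanSpace ℝ (Fin 3))) => t • e) t (R (WithLp.toLp 2 ![y 0, y 1, c]))‖ₑ ^ 2 = ⊤ := by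
  have hne : ‖t • e‖ₑ ^ 2 ≠ 0 := by
    apply pow_ne_zero
    rw [enorm_ne_zero]
    exact smul_ne_zero ht he
  simp only [lintegral_const, measure_univ_of_isAddLeftInvariant]
  exact ENNReal.mul_top hne

/-- **LOAD-BEARING (the Leray–Hopf clause).** The inner hypothesis of
`PlaneEnergyCeiling.BoundedPlanarEnergyRegularity` with the clause `IsLerayHopfOn T ν 0 (u 0) u`
DROPPED (everything else verbatim) is FALSE at the zero datum, for every `ν`: the drift
`t • e₁` from `u 0 = 0` has planar energy `⊤` at `t = 1/2 ∈ [0, 1)`. Hence the LH-free crux holds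
only vacuously there; any proof of the crux as stated must use the finite-energy clause. [folklore] -/
theorem planar_bound_false_without_lerayHopf (ν : ℝ) :
    ¬ (∀ (T : ℝ), 0 < T → ∀ (u : ℝ → EuclideanSpace ℝ (Fin 3) → EuclideanSpace ℝ (Fin 3))
        (p : ℝ → EuclideanSpace ℝ (Fin 3) → ℝ),
        Literature.Analysis.FluidPDE.IsClassicalNSSolutionOn (Set.Ico 0 T) ν 0 u p → u 0 = 0 →
        ∃ M : ℝ, ∀ t ∈ Set.Ico 0 T,
          ∀ (R : EuclideanSpace ℝ (Fin 3) ≃ₗᵢ[ℝ] EuclideanSpace ℝ (Fin 3)) (c : ℝ),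
            ∫⁻ y : EuclideanSpace ℝ (Fin 2), ‖u t (R (WithLp.toLp 2 ![y 0, y 1, c]))‖ₑ ^ 2
              ≤ ENNReal.ofReal M) := by
  intro h
  set e₁ : (EuclideanSpace ℝ (Fin 3)) := EuclideanSpace.single 0 1 with he₁
  have he : e₁ ≠ 0 := by
    intro h0
    have := congrArg (fun v : (EuclideanSpace ℝ (Fin 3)) => v 0) h0
    simp [he₁] at this
  have hu0 : (fun (t : ℝ) (_ : (EuclideanSpace ℝ (Fin 3))) => t • e₁) 0 = 0 := by
    funext x
    simp
  obtain ⟨M, hM⟩ := h 1 one_pos (fun (t : ℝ) (_ : (EuclideanSpace ℝ (Fin 3))) => t • e₁) (fun (_ : ℝ) (x : (EuclideanSpace ℝ (Fin 3))) => -⟪e₁, x⟫)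
    (isClassicalNSSolutionOn_accelDrift ν 1 e₁) hu0
  have h12 : (1 / 2 : ℝ) ∈ Ico (0 : ℝ) 1 := ⟨by norm_num, by norm_num⟩
  have hle := hM (1 / 2) h12 (LinearIsometryEquiv.refl ℝ (EuclideanSpace ℝ (Fin 3))) 0
  rw [planarEnergy_accelDrift_eq_top he (by norm_num) (LinearIsometryEquiv.refl ℝ (EuclideanSpace ℝ (Fin 3))) 0] at hle
  exact ENNReal.ofReal_ne_top (top_le_iff.1 hle)

end Summit.NavierStokesRegularity.NavierStokesRegularity.Theorems.BoundedPlanarEnergyRegularityNegative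

end
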